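import Summits.NavierStokesRegularity.FluidComputer.GateBudgetLeakCeiling
import HarnessLib

/-!
# GateBudget part 78 — the phase weight of a pinned lattice pulse (§231–§232)

Cell `pub-fluidc`, blueprint seat bp1 (gen 36, fifth item: THE d-LEDGER II, SPEC-INPUT-bp1
§BJ/§BK); namespace `Summit.NavierStokesRegularity.FluidComputer.GateBudget`, headline member
`M = K¹⁰` of the two-scale family `RotorKnob.rotorCircuit K M ε ρ` from `delayInit` on the
resonance lattice `ε = kK¹⁰ρ²` (`k ≥ 1`, `K ≥ 0`, `ε > 0`; the numerics at `K ≥ 16`).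
HONEST FRAMING: a low prior, high value-of-information experiment on Tao's machine paradigm;
NOT a claim that NS blows up.

WHAT. The PHASE WEIGHT of a pulse `[r, T']` is `W = ∫_r |sin Φ|`, `Φ = (C - C(r))/ρ²` the
dose phase (`C' = c`). It is the quantity that multiplies the drift of the transfer mode
across the pulse (part 79 §233: in the co-rotating frame the transfer coordinate is forced
only through `sin Φ`), and on a PINNED LATTICE PULSE it is `O(k/K¹⁰)`, not
`O(T' - r) = O(1/K⁹)`: the phase sits at `0` during the climb and at `kπ` during the fall,
and moves only during the `O(1/K¹⁰)` swing. §231 `weight_climb`: while the clock is charged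
(`b ≥ β > 0` on `[r, t₁]`) the phase is slaved to the trigger, `0 ≤ Φ ≤ kc/β` (part 74
§224: `kμ = 1/ρ²`, `c' ≥ μβc`, `μ = K¹⁰/ε`), so
  `W(t₁) - W(r) ≤ k(c(t₁) - c(r))/(μβ²)`.
§232 `weight_fall`: while the clock is reversed (`b ≤ -β' < 0` on `[t₂, T']`) and the exit
phase is pinned (`|Φ(T') - kπ| ≤ δ`), the remaining phase is slaved to the trigger,
`0 ≤ Φ(T') - Φ ≤ kc/β' + ξ` (part 74 §225: `c' ≤ σ - μβ'c`, `σ = ρ²e^{-K¹⁰}`,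
`ξ = kσ(T' - r)/β'`), so
  `W(T') - W(t₂) ≤ (δ + ξ)(T' - t₂) + k(σ(T' - t₂) + c(t₂) - c(T'))/(μβ'²)`.
`weight_numerics` adds the pieces at the data of part 73 §223 (`β = (31/32)θε`,
`β' = (15/16)θε`, `θ ≥ 5/4`, `c(t₁), c(t₂) ≤ θε/4`, swing `≤ 4.16/(θK¹⁰)`,
`T' - r ≤ 242/K⁹`, `kσ ≤ ε/K¹⁰`): in all `W(T') - W(r) ≤ (0.45k + 3.4)/K¹⁰ + 242δ/K⁹`.

WHY (the d-ledger, SPEC-INPUT-bp1 §BJ). Part 14 §43's co-rotating drift bounds the transfer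
mode across a pulse by `2L(T' - r)`, `L ≍ Kã`: summed over the `≍ K⁹` rungs of the ladder
this is `O(1)` and useless for the ledger `d_{n+1} ≤ e^{-(9/4)Kã(T'_n)}·d_n + ι_n` (cold
half: part 77 §229). The weight `∫|sin Φ|` replaces the pulse length `242/K⁹` by
`≈ 0.45k/K¹⁰` per rung, which the cold damping `e^{-(9/4)Kã}` absorbs
(`x·e^{-(9/4)x} ≤ 4/(9e)`): the injection `ι_n` becomes `O(k/K⁹ + δ)` uniformly in the
output level. Part 79 turns the weight into the fine transfer law
`|d(T')| ≤ |d(r)| + δ + (2ε² + σ + Kã(T'))·(W(T') - W(r))`.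

HONEST LIMITS. (i) `W` is any primitive of `|sin Φ|` (hypothesis `HasDerivAt W |sin Φ|`);
the file integrates nothing itself; (ii) the clock levels `β, β'`, the pin `δ` and the phase
data are HYPOTHESES here (conclusions of parts 52/71/73 at their data); (iii) the constants
`0.45`, `3.4` are generous (`(256/961)(4/5) + 256/1125 = 0.4407`, `4.16·(4/5) = 3.328`);
the swing is bounded by its bare length (`|sin| ≤ 1`), which is where `3.4/K¹⁰` comes from;
(iv) nothing about the transfer mode itself (part 79), the output budget or Navier–Stokes.
[cite: Tao2016AveragedNS, §5.5 Theorem 5.3, (5.5), (b-eq), (c-eq), (energy-con), (est)]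
-/

noncomputable section

namespace Summit.NavierStokesRegularity.FluidComputer.GateBudget

open Real Set Filter Topology
open Literature.Analysis.FluidPDE.Tao2016AveragedNS

variable {K ε ρ : ℝ} {X : ℝ → Fin 5 → ℝ} {C : ℝ → ℝ}

/-! ## §231 The climb: the phase sits at `0` -/

/-- §231 **PHASE WEIGHT ON THE CLIMB** (headline member, lattice `ε = kK¹⁰ρ²`, `K ≥ 0`,
`ε > 0`). On `[r, t₁]` (`r ≥ 0`) with the clock charged, `b ≥ β > 0`, every primitive `W` of
the phase weight `|sin Φ|` (`Φ = (C - C(r))/ρ²`) gains at most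
`W(t₁) - W(r) ≤ k(c(t₁) - c(r))/(μβ²)`, `μ = K¹⁰/ε`: the phase is slaved to the trigger,
`0 ≤ Φ ≤ kc/β` (part 74 §224: `kμ = 1/ρ²`, `c' ≥ μβc`), so `|sin Φ| ≤ kc/β ≤ kc'/(μβ²)` and
`W - kc/(μβ²)` is non-increasing. [derived: part 74 §224; this file] -/
theorem weight_climb
    (hX : ∀ t, HasDerivAt X (RotorKnob.rotorCircuit K (K ^ 10) ε ρ (X t)) t)
    (h0 : X 0 = delayInit) (hC : ∀ t, HasDerivAt C (X t 2) t) (hK : 0 ≤ K) (hε : 0 < ε)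
    (k : ℕ) (hk : ε = k * K ^ 10 * ρ ^ 2) {r t₁ β : ℝ} {W : ℝ → ℝ} (hr : 0 ≤ r)
    (hrt : r ≤ t₁) (hβ : 0 < β) (hb : ∀ u ∈ Icc r t₁, β ≤ X u 1)
    (hW : ∀ u ∈ Icc r t₁, HasDerivAt W (|sin ((C u - C r) / ρ ^ 2)|) u) :
    W t₁ - W r ≤ k * (X t₁ 2 - X r 2) / (ε⁻¹ * K ^ 10 * β ^ 2) := by
  obtain ⟨μ, hμ⟩ : ∃ μ : ℝ, μ = ε⁻¹ * K ^ 10 := ⟨_, rfl⟩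
  obtain ⟨σ, hσ⟩ : ∃ σ : ℝ, σ = ρ ^ 2 * exp (-K ^ 10) := ⟨_, rfl⟩
  rw [← hμ]
  have hσ0 : 0 ≤ σ := by rw [hσ]; positivity
  have hc0 : ∀ u ∈ Icc r t₁, 0 ≤ X u 2 := fun u hu => RotorKnob.c_nonneg hX h0 (hr.trans hu.1)
  obtain ⟨hk0, hK10, hkμ⟩ := lattice_phase_unit hK hε hk hμ
  have hμ0 : 0 < μ := by rw [hμ]; positivity
  -- the dose phase is non-negative and slaved to the trigger (part 74 §224)
  have hΦd : ∀ u, HasDerivAt (fun s => (C s - C r) / ρ ^ 2) (X u 2 / ρ ^ 2) u := fun u =>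
    ((hC u).sub_const (C r)).div_const (ρ ^ 2)
  have hCmono := Thm53.monotoneOn_sub_of_le_deriv (f := C) (f' := fun u => X u 2)
    (Φ := fun _ => (0 : ℝ)) (φ := fun _ => 0) (convex_Icc r t₁) (fun u _ => hC u)
    (fun u _ => hasDerivAt_const u 0) (fun u hu => hc0 u hu)
  have hΦ0 : ∀ u ∈ Icc r t₁, 0 ≤ (C u - C r) / ρ ^ 2 := by
    intro u hu
    have h := hCmono (left_mem_Icc.2 hrt) hu hu.1
    dsimp only at h
    exact div_nonneg (by linarith only [h]) (sq_nonneg ρ)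
  have hV := Thm53.monotoneOn_sub_of_le_deriv (f := fun u => k * X u 2 / β)
    (f' := fun u => k * (ρ ^ 2 * exp (-K ^ 10) * X u 0 ^ 2 + ε⁻¹ * K ^ 10 * X u 1 * X u 2) / β)
    (Φ := fun u => (C u - C r) / ρ ^ 2) (φ := fun u => X u 2 / ρ ^ 2) (convex_Icc r t₁)
    (fun u _ => ((RotorKnob.hasDerivAt_c hX u).const_mul (k : ℝ)).div_const β)
    (fun u _ => hΦd u)
    (fun u hu => by
      have hcu := hc0 u hu
      show X u 2 / ρ ^ 2
          ≤ k * (ρ ^ 2 * exp (-K ^ 10) * X u 0 ^ 2 + ε⁻¹ * K ^ 10 * X u 1 * X u 2) / β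
      rw [div_eq_mul_inv (X u 2), ← hkμ, ← hσ, ← hμ, le_div_iff₀ hβ]
      have h1 : 0 ≤ k * (σ * X u 0 ^ 2) := by positivity
      have h2 : β * X u 2 ≤ X u 1 * X u 2 := mul_le_mul_of_nonneg_right (hb u hu) hcu
      have h3 := mul_le_mul_of_nonneg_left h2 (by positivity : (0 : ℝ) ≤ k * μ)
      nlinarith only [h1, h3])
  have hΦle : ∀ u ∈ Icc r t₁, (C u - C r) / ρ ^ 2 ≤ k * X u 2 / β := by
    intro u hu
    have h := hV (left_mem_Icc.2 hrt) hu hu.1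
    dsimp only at h
    rw [sub_self, zero_div, sub_zero] at h
    have : 0 ≤ k * X r 2 / β :=
      div_nonneg (mul_nonneg k.cast_nonneg (hc0 r (left_mem_Icc.2 hrt))) hβ.le
    linarith only [h, this]
  -- the comparison function `W - kc/(μβ²)`
  have hanti := Thm53.antitoneOn_sub_of_deriv_le (f := W)
    (f' := fun u => |sin ((C u - C r) / ρ ^ 2)|) (Φ := fun u => k * X u 2 / (μ * β ^ 2))
    (φ := fun u => k * (ρ ^ 2 * exp (-K ^ 10) * X u 0 ^ 2 + ε⁻¹ * K ^ 10 * X u 1 * X u 2)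
      / (μ * β ^ 2)) (convex_Icc r t₁) (fun u hu => hW u hu)
    (fun u _ => ((RotorKnob.hasDerivAt_c hX u).const_mul (k : ℝ)).div_const (μ * β ^ 2))
    (fun u hu => by
      have hcu := hc0 u hu
      set c' : ℝ := ρ ^ 2 * exp (-K ^ 10) * X u 0 ^ 2 + ε⁻¹ * K ^ 10 * X u 1 * X u 2 with hc'
      -- `|sin Φ| ≤ Φ ≤ kc/β`
      have h1 : |sin ((C u - C r) / ρ ^ 2)| ≤ k * X u 2 / β :=
        calc |sin ((C u - C r) / ρ ^ 2)| ≤ |(C u - C r) / ρ ^ 2| := abs_sin_le_abs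
          _ = (C u - C r) / ρ ^ 2 := abs_of_nonneg (hΦ0 u hu)
          _ ≤ k * X u 2 / β := hΦle u hu
      -- exponential growth `μβc ≤ c'`
      have hgrow : μ * β * X u 2 ≤ c' := by
        rw [hc', ← hσ, ← hμ]
        have e1 : 0 ≤ σ * X u 0 ^ 2 := by positivity
        have e2 : β * X u 2 ≤ X u 1 * X u 2 := mul_le_mul_of_nonneg_right (hb u hu) hcu
        have e3 := mul_le_mul_of_nonneg_left e2 hμ0.le
        nlinarith only [e1, e3]
      -- `kc/β ≤ kc'/(μβ²)`
      have h2 : k * X u 2 / β ≤ k * c' / (μ * β ^ 2) := by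
        rw [div_le_div_iff₀ hβ (by positivity)]
        have e := mul_le_mul_of_nonneg_left hgrow (by positivity : (0 : ℝ) ≤ k * β)
        nlinarith only [e]
      exact h1.trans h2)
  have h := hanti (left_mem_Icc.2 hrt) (right_mem_Icc.2 hrt) hrt
  dsimp only at h
  have e : k * (X t₁ 2 - X r 2) / (μ * β ^ 2)
      = k * X t₁ 2 / (μ * β ^ 2) - k * X r 2 / (μ * β ^ 2) := by
    ring
  linarith only [h, e]

/-! ## §232 The fall: the phase sits at `kπ` -/

/-- §232 **PHASE WEIGHT ON THE FALL** (headline member, lattice `ε = kK¹⁰ρ²`, `K ≥ 0`,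
`ε > 0`). On `[t₂, T']` (`0 ≤ r ≤ t₂`) with the clock reversed, `b ≤ -β' < 0`, and the exit
phase pinned, `|Φ(T') - kπ| ≤ δ`, every primitive `W` of `|sin Φ|` gains at most
`W(T') - W(t₂) ≤ (δ + ξ)(T' - t₂) + k(σ(T' - t₂) + c(t₂) - c(T'))/(μβ'²)`, `μ = K¹⁰/ε`,
`σ = ρ²e^{-K¹⁰}`, `ξ = kσ(T' - r)/β'`: the remaining phase is slaved to the trigger,
`0 ≤ Φ(T') - Φ ≤ kc/β' + ξ` (part 74 §225: `c' ≤ σ - μβ'c`), so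
`|sin Φ| = |sin(Φ - kπ)| ≤ δ + ξ + kc/β' ≤ δ + ξ + k(σ - c')/(μβ'²)`.
[derived: part 74 §225; this file] -/
theorem weight_fall
    (hX : ∀ t, HasDerivAt X (RotorKnob.rotorCircuit K (K ^ 10) ε ρ (X t)) t)
    (h0 : X 0 = delayInit) (hC : ∀ t, HasDerivAt C (X t 2) t) (hK : 0 ≤ K) (hε : 0 < ε)
    (k : ℕ) (hk : ε = k * K ^ 10 * ρ ^ 2) {r t₂ T' β' δ : ℝ} {W : ℝ → ℝ} (hr : 0 ≤ r)
    (hrt : r ≤ t₂) (htT : t₂ ≤ T') (hβ : 0 < β') (hb : ∀ u ∈ Icc t₂ T', X u 1 ≤ -β')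
    (hpin : |(C T' - C r) / ρ ^ 2 - k * π| ≤ δ)
    (hW : ∀ u ∈ Icc t₂ T', HasDerivAt W (|sin ((C u - C r) / ρ ^ 2)|) u) :
    W T' - W t₂ ≤ (δ + k * (ρ ^ 2 * exp (-K ^ 10)) * (T' - r) / β') * (T' - t₂)
      + k * (ρ ^ 2 * exp (-K ^ 10) * (T' - t₂) + X t₂ 2 - X T' 2) / (ε⁻¹ * K ^ 10 * β' ^ 2) := by
  obtain ⟨μ, hμ⟩ : ∃ μ : ℝ, μ = ε⁻¹ * K ^ 10 := ⟨_, rfl⟩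
  obtain ⟨σ, hσ⟩ : ∃ σ : ℝ, σ = ρ ^ 2 * exp (-K ^ 10) := ⟨_, rfl⟩
  obtain ⟨ξ, hξ⟩ : ∃ ξ : ℝ, ξ = k * σ * (T' - r) / β' := ⟨_, rfl⟩
  rw [← hμ, ← hσ, ← hξ]
  have hσ0 : 0 ≤ σ := by rw [hσ]; positivity
  have ht₂0 : 0 ≤ t₂ := hr.trans hrt
  have hc0 : ∀ u ∈ Icc t₂ T', 0 ≤ X u 2 := fun u hu => RotorKnob.c_nonneg hX h0 (ht₂0.trans hu.1)
  obtain ⟨hk0, hK10, hkμ⟩ := lattice_phase_unit hK hε hk hμ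
  have hμ0 : 0 < μ := by rw [hμ]; positivity
  have hξ0 : 0 ≤ ξ := by
    rw [hξ]
    exact div_nonneg (mul_nonneg (mul_nonneg k.cast_nonneg hσ0) (by linarith)) hβ.le
  have hδ : 0 ≤ δ := (abs_nonneg _).trans hpin
  -- the dose phase: non-decreasing, and the remaining phase slaved to the trigger (part 74 §225)
  have hΦd : ∀ u, HasDerivAt (fun s => (C s - C r) / ρ ^ 2) (X u 2 / ρ ^ 2) u := fun u =>
    ((hC u).sub_const (C r)).div_const (ρ ^ 2)
  have hCmono := Thm53.monotoneOn_sub_of_le_deriv (f := C) (f' := fun u => X u 2)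
    (Φ := fun _ => (0 : ℝ)) (φ := fun _ => 0) (convex_Icc t₂ T') (fun u _ => hC u)
    (fun u _ => hasDerivAt_const u 0) (fun u hu => hc0 u hu)
  have hV := Thm53.antitoneOn_sub_of_deriv_le
    (f := fun u => (C u - C r) / ρ ^ 2 + k * X u 2 / β')
    (f' := fun u => X u 2 / ρ ^ 2
      + k * (ρ ^ 2 * exp (-K ^ 10) * X u 0 ^ 2 + ε⁻¹ * K ^ 10 * X u 1 * X u 2) / β')
    (Φ := fun u => k * σ / β' * u) (φ := fun _ => k * σ / β') (convex_Icc t₂ T')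
    (fun u _ => (hΦd u).add (((RotorKnob.hasDerivAt_c hX u).const_mul (k : ℝ)).div_const β'))
    (fun u _ => by simpa using (hasDerivAt_id' u).const_mul (k * σ / β'))
    (fun u hu => by
      have hcu := hc0 u hu
      have ha := RotorKnob.traj_sq_le_one hX h0 u 0
      show X u 2 / ρ ^ 2
          + k * (ρ ^ 2 * exp (-K ^ 10) * X u 0 ^ 2 + ε⁻¹ * K ^ 10 * X u 1 * X u 2) / β'
        ≤ k * σ / β'
      rw [div_eq_mul_inv (X u 2), ← hkμ, ← hσ, ← hμ]
      have e : X u 2 * (k * μ) + k * (σ * X u 0 ^ 2 + μ * X u 1 * X u 2) / β'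
          = (X u 2 * (k * μ) * β' + k * (σ * X u 0 ^ 2 + μ * X u 1 * X u 2)) / β' := by
        rw [add_div, mul_div_cancel_right₀ _ hβ.ne']
      rw [e, div_le_div_iff_of_pos_right hβ]
      have h1 : σ * X u 0 ^ 2 ≤ σ * 1 := mul_le_mul_of_nonneg_left ha hσ0
      have h2 : X u 1 * X u 2 ≤ -β' * X u 2 := mul_le_mul_of_nonneg_right (hb u hu) hcu
      have h3 := mul_le_mul_of_nonneg_left h2 (by positivity : (0 : ℝ) ≤ k * μ)
      have h4 := mul_le_mul_of_nonneg_left h1 hk0.le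
      nlinarith only [h3, h4, hcu, hβ, hk0, hμ0])
  have hrem : ∀ u ∈ Icc t₂ T', 0 ≤ (C T' - C r) / ρ ^ 2 - (C u - C r) / ρ ^ 2 ∧
      (C T' - C r) / ρ ^ 2 - (C u - C r) / ρ ^ 2 ≤ k * X u 2 / β' + ξ := by
    intro u hu
    have h1 := hCmono hu (right_mem_Icc.2 htT) hu.2
    have h2 := hV hu (right_mem_Icc.2 htT) hu.2
    dsimp only at h1 h2
    constructor
    · rw [← sub_div]
      exact div_nonneg (by linarith only [h1]) (sq_nonneg ρ)
    · have hcT := hc0 T' (right_mem_Icc.2 htT)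
      have e1 : k * σ / β' * T' - k * σ / β' * u = k * σ / β' * (T' - u) := by ring
      have e2 : k * σ / β' * (T' - u) ≤ ξ := by
        have hle : T' - u ≤ T' - r := by linarith only [hu.1, hrt]
        calc k * σ / β' * (T' - u) ≤ k * σ / β' * (T' - r) :=
              mul_le_mul_of_nonneg_left hle (div_nonneg (mul_nonneg k.cast_nonneg hσ0) hβ.le)
          _ = ξ := by rw [hξ]; ring
      have e3 : 0 ≤ k * X T' 2 / β' := div_nonneg (mul_nonneg k.cast_nonneg hcT) hβ.le
      linarith only [h2, e1, e2, e3]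
  -- the comparison function `W - ((δ + ξ)u + k(σu - c)/(μβ'²))`
  have hanti := Thm53.antitoneOn_sub_of_deriv_le (f := W)
    (f' := fun u => |sin ((C u - C r) / ρ ^ 2)|)
    (Φ := fun u => (δ + ξ) * u + k * (σ * u - X u 2) / (μ * β' ^ 2))
    (φ := fun u => (δ + ξ) + k * (σ - (ρ ^ 2 * exp (-K ^ 10) * X u 0 ^ 2
      + ε⁻¹ * K ^ 10 * X u 1 * X u 2)) / (μ * β' ^ 2)) (convex_Icc t₂ T') (fun u hu => hW u hu)
    (fun u _ => (((hasDerivAt_id' u).const_mul (δ + ξ)).add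
      (((((hasDerivAt_id' u).const_mul σ).sub (RotorKnob.hasDerivAt_c hX u)).const_mul
        (k : ℝ)).div_const (μ * β' ^ 2))).congr_deriv (by ring))
    (fun u hu => by
      have hcu := hc0 u hu
      have ha := RotorKnob.traj_sq_le_one hX h0 u 0
      set c' : ℝ := ρ ^ 2 * exp (-K ^ 10) * X u 0 ^ 2 + ε⁻¹ * K ^ 10 * X u 1 * X u 2 with hc'
      -- `|sin Φ| = |sin(Φ - kπ)| ≤ |Φ - kπ| ≤ δ + kc/β' + ξ`
      obtain ⟨x, hx⟩ : ∃ x : ℝ, x = (C u - C r) / ρ ^ 2 - k * π := ⟨_, rfl⟩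
      obtain ⟨hu0, hu1⟩ := hrem u hu
      have hpin' := abs_le.1 hpin
      have hxabs : |x| ≤ δ + (k * X u 2 / β' + ξ) := by
        refine abs_le.2 ⟨?_, ?_⟩
        · rw [hx]; linarith only [hpin'.1, hu1]
        · have hq : 0 ≤ k * X u 2 / β' := div_nonneg (mul_nonneg k.cast_nonneg hcu) hβ.le
          rw [hx]; linarith only [hpin'.2, hu0, hq, hξ0]
      have h1 : |sin ((C u - C r) / ρ ^ 2)| ≤ δ + (k * X u 2 / β' + ξ) := by
        have e : (C u - C r) / ρ ^ 2 = x + k * π := by rw [hx]; ring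
        rw [e, sin_add_nat_mul_pi, abs_mul, abs_pow, abs_neg, abs_one, one_pow, one_mul]
        exact abs_sin_le_abs.trans hxabs
      -- exponential decay `μβ'c ≤ σ - c'`
      have hdecay : μ * β' * X u 2 ≤ σ - c' := by
        rw [hc', ← hσ, ← hμ]
        have e1 : σ * X u 0 ^ 2 ≤ σ * 1 := mul_le_mul_of_nonneg_left ha hσ0
        have e2 : X u 1 * X u 2 ≤ -β' * X u 2 := mul_le_mul_of_nonneg_right (hb u hu) hcu
        have e3 := mul_le_mul_of_nonneg_left e2 hμ0.le
        nlinarith only [e1, e3]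
      -- `kc/β' ≤ k(σ - c')/(μβ'²)`
      have h2 : k * X u 2 / β' ≤ k * (σ - c') / (μ * β' ^ 2) := by
        rw [div_le_div_iff₀ hβ (by positivity)]
        have e := mul_le_mul_of_nonneg_left hdecay (by positivity : (0 : ℝ) ≤ k * β')
        nlinarith only [e]
      linarith only [h1, h2])
  have h := hanti (left_mem_Icc.2 htT) (right_mem_Icc.2 htT) htT
  dsimp only at h
  have e : (δ + ξ) * (T' - t₂) + k * (σ * (T' - t₂) + X t₂ 2 - X T' 2) / (μ * β' ^ 2)
      = ((δ + ξ) * T' + k * (σ * T' - X T' 2) / (μ * β' ^ 2))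
        - ((δ + ξ) * t₂ + k * (σ * t₂ - X t₂ 2) / (μ * β' ^ 2)) := by ring
  linarith only [h, e]

/-! ## The numerics of a pinned lattice pulse -/
/-- The numerics of the phase weight of a pinned lattice pulse (`K ≥ 16`, `θ ≥ 5/4`, `k ≥ 1`,
`0 ≤ s ≤ ε/K¹⁰`, `0 ≤ τ₂ ≤ τ ≤ 242/K⁹`): climb `(256/961)k/(θK¹⁰)`, swing `4.16/(θK¹⁰)`, fall
`(256/225)k/(4θK¹⁰)` up to `e^{-K¹⁰}`-junk, in all at most `(0.45k + 3.4)/K¹⁰ + 242δ/K⁹`.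
[derived: arithmetic] -/
theorem weight_numerics (hK : 16 ≤ K) (hε : 0 < ε) {θ k δ s τ τ₂ : ℝ} (hθ1 : 5 / 4 ≤ θ)
    (hk1 : 1 ≤ k) (hδ : 0 ≤ δ) (hs0 : 0 ≤ s) (hs : s ≤ ε / K ^ 10) (hτ₂ : 0 ≤ τ₂)
    (hτ₂τ : τ₂ ≤ τ) (hτ : τ ≤ 242 / K ^ 9) :
    k * (θ * ε / 4) / (ε⁻¹ * K ^ 10 * (31 / 32 * θ * ε) ^ 2) + 4.16 / (θ * K ^ 10)
      + ((δ + s * τ / (15 / 16 * θ * ε)) * τ₂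
        + (s * τ₂ + k * (θ * ε / 4)) / (ε⁻¹ * K ^ 10 * (15 / 16 * θ * ε) ^ 2))
      ≤ (0.45 * k + 3.4) / K ^ 10 + 242 * δ / K ^ 9 := by
  have hK0 : (0 : ℝ) < K := by linarith
  have hK9 : (2 : ℝ) ^ 36 ≤ K ^ 9 := by
    calc (2 : ℝ) ^ 36 = 16 ^ 9 := by norm_num
      _ ≤ K ^ 9 := pow_le_pow_left₀ (by norm_num) hK 9
  have hK10 : (0 : ℝ) < K ^ 10 := by positivity
  have hK10' : (1 : ℝ) ≤ K ^ 10 := one_le_pow₀ (by linarith)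
  have hθ0 : (0 : ℝ) < θ := by linarith
  have hk0 : (0 : ℝ) ≤ k := by linarith
  have hτ0 : 0 ≤ τ := hτ₂.trans hτ₂τ
  have hτs : τ ≤ 1 / 10 ^ 8 := by
    have h1 : (242 : ℝ) / K ^ 9 ≤ 242 / 2 ^ 36 :=
      div_le_div_of_nonneg_left (by norm_num) (by positivity) hK9
    have h2 : (242 : ℝ) / 2 ^ 36 ≤ 1 / 10 ^ 8 := by norm_num
    linarith
  have hτ₂s : τ₂ ≤ 1 / 10 ^ 8 := hτ₂τ.trans hτs
  have hεK : ε / K ^ 10 ≤ ε := by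
    rw [div_le_iff₀ hK10]
    nlinarith [mul_le_mul_of_nonneg_left hK10' hε.le]
  have hsε : s ≤ ε := hs.trans hεK
  have hθne : θ ≠ 0 := hθ0.ne'
  have hεne : ε ≠ 0 := hε.ne'
  have hKne : K ≠ 0 := hK0.ne'
  -- normal forms in `u = 1/K¹⁰`
  set u : ℝ := (K ^ 10)⁻¹ with hu
  have hu0 : 0 < u := by positivity
  have e1 : k * (θ * ε / 4) / (ε⁻¹ * K ^ 10 * (31 / 32 * θ * ε) ^ 2)
      = 256 / 961 * (k / θ) * u := by
    rw [hu]; field_simp; ring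
  have e2 : (4.16 : ℝ) / (θ * K ^ 10) = 4.16 / θ * u := by
    rw [hu]; field_simp
  have e3 : (s * τ₂ + k * (θ * ε / 4)) / (ε⁻¹ * K ^ 10 * (15 / 16 * θ * ε) ^ 2)
      = 256 / 225 * ((s * τ₂ / ε + k * θ / 4) / θ ^ 2) * u := by
    rw [hu]; field_simp; ring
  have e4 : (0.45 * k + 3.4) / K ^ 10 = (0.45 * k + 3.4) * u := by rw [hu, div_eq_mul_inv]
  -- the pieces
  have i1 : k / θ ≤ 4 / 5 * k := by
    rw [div_le_iff₀ hθ0]; nlinarith [mul_le_mul_of_nonneg_left hθ1 hk0]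
  have i2 : (4.16 : ℝ) / θ ≤ 3.328 := by
    rw [div_le_iff₀ hθ0]; linarith
  have i3 : s * τ₂ / ε ≤ 1 / 10 ^ 8 := by
    rw [div_le_iff₀ hε]
    calc s * τ₂ ≤ ε * (1 / 10 ^ 8) := mul_le_mul hsε hτ₂s hτ₂ hε.le
      _ = 1 / 10 ^ 8 * ε := by ring
  have i4 : (s * τ₂ / ε + k * θ / 4) / θ ^ 2 ≤ 1 / 10 ^ 8 + k / 5 := by
    rw [div_le_iff₀ (by positivity)]
    have hθ2 : (5 / 4 : ℝ) * (5 / 4) ≤ θ * θ := mul_le_mul hθ1 hθ1 (by norm_num) hθ0.le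
    have hkθ := mul_le_mul_of_nonneg_left hθ1 (mul_nonneg hk0 hθ0.le)
    nlinarith [i3, hθ2, hkθ]
  have i5 : s * τ / (15 / 16 * θ * ε) * τ₂ ≤ 1 / 10 ^ 16 * u := by
    have hden : 0 < 15 / 16 * θ * ε := by positivity
    have hA : s * τ / (15 / 16 * θ * ε) ≤ 1 / 10 ^ 8 * u := by
      rw [div_le_iff₀ hden]
      have h1 : s * τ ≤ ε / K ^ 10 * (1 / 10 ^ 8) := mul_le_mul hs hτs hτ0 (by positivity)
      have h1' : ε / K ^ 10 = ε * u := by rw [hu, div_eq_mul_inv]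
      rw [h1'] at h1
      have h2 : u * ε * (5 / 4) ≤ u * ε * θ := mul_le_mul_of_nonneg_left hθ1 (by positivity)
      have h3 : 0 ≤ u * ε := by positivity
      linarith [h1, h2, h3]
    calc s * τ / (15 / 16 * θ * ε) * τ₂ ≤ 1 / 10 ^ 8 * u * (1 / 10 ^ 8) :=
          mul_le_mul hA hτ₂s hτ₂ (by positivity)
      _ = 1 / 10 ^ 16 * u := by ring
  have i6 : δ * τ₂ ≤ 242 * δ / K ^ 9 := by
    calc δ * τ₂ ≤ δ * (242 / K ^ 9) := mul_le_mul_of_nonneg_left (hτ₂τ.trans hτ) hδ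
      _ = 242 * δ / K ^ 9 := by ring
  have eL : k * (θ * ε / 4) / (ε⁻¹ * K ^ 10 * (31 / 32 * θ * ε) ^ 2) + 4.16 / (θ * K ^ 10)
      + ((δ + s * τ / (15 / 16 * θ * ε)) * τ₂
        + (s * τ₂ + k * (θ * ε / 4)) / (ε⁻¹ * K ^ 10 * (15 / 16 * θ * ε) ^ 2))
      = 256 / 961 * (k / θ) * u + 4.16 / θ * u + δ * τ₂ + s * τ / (15 / 16 * θ * ε) * τ₂
        + 256 / 225 * ((s * τ₂ / ε + k * θ / 4) / θ ^ 2) * u := by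
    rw [e1, e2, e3]; ring
  rw [eL, e4]
  have j1 := mul_le_mul_of_nonneg_right i1 hu0.le
  have j2 := mul_le_mul_of_nonneg_right i2 hu0.le
  have j4 := mul_le_mul_of_nonneg_right i4 hu0.le
  linarith [j1, j2, j4, i5, i6, mul_nonneg hk0 hu0.le, hu0.le]

end Summit.NavierStokesRegularity.FluidComputer.GateBudget
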